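import Summits.QuantumFields.BalabanUV.Beta.GAN24.MonotoneTorusEffective

/-!
# Beta / GAN24 / MonotoneTorusSoft — (MONO-K) FOR THE SOFT (GAUSSIAN-WEIGHTED) AVERAGING CONSTRAINT: the plaquette covariance of the
# unit-lattice field under `2Δ_k + a′·Rₛᴴ Rₛ` (Bałaban's `k`-step block action PLUS a quadratic averaging weight), hard rows `R_h`, is
# Loewner-antitone in `k` for every weight `a′ ≥ 0` — the canonical constrained covariance is ANTITONE IN THE FORM on legitimate sources
# (gan24-p4 gen 4; BINDER-OWNERS row G-an2-4 ∕ (CONV-C), ALTERNATIVE DISCHARGE «rate OR monotonicity»; NOT IN PRINT — our proof attempt)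

HONEST FRAMING (page 1 of everything the β sub-cell writes): discharging `BetaPertH` makes Bałaban's UV stability UNCONDITIONAL — a
real constructive-QFT result; it is NOT the continuum limit and NOT the Clay problem.  HONEST DEPENDENCY (cell reorg 2026-08-19, verbatim):
«continuum YM on T⁴ ⇐ BetaPertH ∧ nine spine estimates (0/9 proved); BetaPertH ⇐ (D1) ∧ (D4) ∧ CAP+tail; G-an2-4 gates asym, D1 and NE2/3/4.»
HONEST LABEL: «not in print; our proof attempt; alternative discharge of the G-an2-4 row (rate OR monotonicity)»; 0 wall binders instantiated.
ABSOLUTE RULE honoured: nothing is cited; [folklore] finite-dimensional linear algebra over `MonotoneCoarsen` ∕ `MonotoneCritical` ∕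
`MonotoneShorted` ∕ `MonotoneTorusEffective`; the printed object `Δ_k` enters as the TREE def `Beta.BlockEffectiveAction.DelK` BY NAME.

## WHY
`MonotoneTorusEffective.critCov_DelK_plaq_antitone_step` is the HARD-constraint (δ-function) form of the averaging: the next block averages
`R B` are set to zero — the averaging OF RECORD for Bałaban's GAUGE field ([B5] (1.12)∕(1.17) `δ(B − Q_kA)`; (1.68)–(1.69) insert `a⟨A,Q*QA⟩`
UNDER those δ-functions as an auxiliary regularisation, whence the tree's `DelK_indep`; [B12] (0.13)–(0.19)).  A GAUSSIAN-weighted block averaging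
`exp(−a′·Σ|B′ − (QB)|²)` with a level-independent weight is the SCALAR-field device of the template (Dimock, «The renormalization group according
to Balaban I», §2.1) — v1.2 DOCFIX of the v1 locator «[B5] (1.5), (1.68)», conceded to the cross-read C-gan24leaf16-g17-1.  THIS FILE is the
ROBUSTNESS EXTENSION of (MONO-K) to such a weight on the NEXT averaging: in the one-step picture on the unit lattice — field `B` with the HARD
`k`-step action `⟨B, Δ_kB⟩`, next averaging `Rₛ = Q_{Lc}` weighed with `a′` (the same `a′` at the two levels compared) — the gauge-invariant content
of the step-`(k+1)` fluctuation covariance is the plaquette block of the canonical covariance of the degenerate form `2Δ_k + a′·RₛᴴRₛ` (plus,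
optionally, hard rows `R_h`).  NOT modelled and NOT claimed (cross-read C-gan24leaf16-g18-1): a tower Gaussian-averaged at EVERY level, whose block
action is the PARALLEL SUM `(Δ_k⁻¹ + a_k⁻¹)⁻¹` with a level-dependent `a_k` (scalar template) — not of the form «hard `Δ_k` + fixed weight».  Since `Δ_k`
increases with `k` (`MonotoneTorusEffective.effAction_step_mono`) and the canonical constrained covariance is ANTITONE IN THE FORM on sources
invisible to the constrained zero modes (§1, the `C = 1` case of gen 2's `MonotoneCoarsen.pairing_coarsen_le`), that content DECREASES with `k`
for every `a′ ≥ 0`.  (The exact printed normalisation of the weight — powers of `Lc`, the `½` — is immaterial: any `k`-independent `a′ ≥ 0`.)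

## WHAT IS PROVED
* §1 (abstract, every RCLike field) `qfun_mono_form`, **`readOut_critCov_antitone_form`**: `H ≤ H′` PSD, hard rows `Q`, a test matrix `T` killing
  `ker Q ∩ ker H` ⟹ `T·critCov H′ Q·Tᴴ ≤ T·critCov H Q·Tᴴ` (Loewner).
* §2 (torus) `softForm k Rₛ a′ := effAction k + a′ • RₛᴴRₛ` (`= 2 • DelK (Lc^k) + a′ • RₛᴴRₛ`, `softForm_eq_DelK`); Hermitian, PSD; `softForm_mono`
  (monotone in `k` AND in the weight); `curlMat_of_softForm_ker` (its constrained zero modes are invisible to the plaquettes).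
* §3 **`softPlaqCov k := curlMat · critCov (softForm k Rₛ a′) R_h · curlMatᴴ`**; **`softPlaqCov_antitone_step`** (Loewner-antitone in `k`, every
  `a′ ≥ 0`, every `Rₛ, R_h`); `softPlaqCov_antitone_weight` (antitone in the weight); `softPlaqCov_zero_weight` (`a′ = 0` recovers gen 3's `plaqCov R_h k`).
* §4 (v1.1, append-only) `genForm k W := effAction k + W` for ANY `k`-independent PSD weight `W` added to the HARD `k`-step action (e.g. §2's Gaussian
  weight `a′·RₛᴴRₛ` on the next averaging, or the shift `a·1` of the block average's marginal precision `(Q_kG_aQ_k*)⁻¹ = a·1 + Δ_k`, tree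
  `QGQ_inv_eq`, [B5] (1.102)); **`genPlaqCov_antitone_step`∕`genPlaqCov_antitone`**; `genPlaqCov_weight_eq_softPlaqCov`.  (v1.2 DOCFIX: the v1.1 gloss
  «the printed soft scheme's `Δ_k + a·1 + a′·Q_LᴴQ_L`» is WITHDRAWN — an all-soft tower's block action is the parallel sum `(Δ_k⁻¹ + a_k⁻¹)⁻¹`, not
  `Δ_k + a·1`; its (MONO-K) is not of §4's form and is NOT claimed.)
* §5 (v1.2, append-only) THE SANDWICH: `readOut_critCov_rows_le_weight` (abstract: more hard rows under `H` ≤ a soft weight under `H′ = H` on `ker Rₛ`),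
  **`plaqCov_hardRows_le_softPlaqCov`** ∕ `softPlaqCov_le_plaqCov`: `plaqCov (Rₛ ⊕ R_h) k ≤ softPlaqCov k Rₛ a′ R_h ≤ plaqCov R_h k` for every `a′ ≥ 0`
  (the hard constraint IS the infimum), `plaqCov_antitone_rows`.
No rate, no constant, no datum value; torus avatar, `U = 1`; NOT (CONV-C), NOT BetaPertH, NOT continuum, NOT Clay.
-/

noncomputable section

namespace Summit.QuantumFields.BalabanUV.Beta.GAN24.MonotoneTorusSoft

open Matrix
open scoped ComplexOrder
open Literature.MathematicalPhysics.QuantumFieldTheory.Balaban1983to89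
open Literature.MathematicalPhysics.QuantumFieldTheory.Balaban1983to89.B5Prop11Plancherel (Tor fine)
open Literature.MathematicalPhysics.QuantumFieldTheory.Balaban1983to89.Beta.BlockEffectiveAction (DelK)
open Summit.QuantumFields.BalabanUV.Beta.GAN24.MonotoneCoarsen (IsCrit qfun conj_pairing qfun_le_of_isCrit qfun_crit_eq_pairing)
open Summit.QuantumFields.BalabanUV.Beta.GAN24.MonotoneCritical (critCov critCov_isHermitian isCrit_critCov critCov_mem_ker)
open Summit.QuantumFields.BalabanUV.Beta.GAN24.MonotoneShorted (readOut_quad)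
open Summit.QuantumFields.BalabanUV.Beta.GAN24.MonotoneTorusTower (curlMat)
open Summit.QuantumFields.BalabanUV.Beta.GAN24.MonotoneTorusPlaquette (plaqCov)
open Summit.QuantumFields.BalabanUV.Beta.GAN24.MonotoneTorusEffective (effAction effAction_isHermitian effAction_posSemidef
  effAction_step_mono effAction_eq_two_smul_DelK one_le_pow_Lc curlMat_of_effAction_ker plaqCov_eq_critCov_effAction critCov_congr)

/-! ## §1 The canonical constrained covariance is antitone in the form (abstract) -/

section Abstract

variable {𝕜 : Type*} [RCLike 𝕜] {n m τ : Type*} [Fintype n] [DecidableEq n] [Fintype m] [DecidableEq m] [Fintype τ]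

omit [DecidableEq n] [Fintype m] [DecidableEq m] [Fintype τ] in
/-- A larger form has a smaller variational functional: `(H′ − H).PosSemidef ⟹ qfun H′ r v ≤ qfun H r v`. [folklore] -/
theorem qfun_mono_form {H H' : Matrix n n 𝕜} (hle : (H' - H).PosSemidef) (r v : n → 𝕜) : qfun H' r v ≤ qfun H r v := by
  have h0 := hle.dotProduct_mulVec_nonneg v
  rw [sub_mulVec, dotProduct_sub, sub_nonneg] at h0
  unfold qfun
  exact sub_le_sub_left h0 _

omit [DecidableEq n] [Fintype m] [DecidableEq m] [Fintype τ] in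
/-- The constrained zero modes of the larger form are constrained zero modes of the smaller one. [folklore] -/
theorem ker_of_ker_larger {H H' : Matrix n n 𝕜} (hH : H.PosSemidef) (hle : (H' - H).PosSemidef) {z : n → 𝕜} (hz : H' *ᵥ z = 0) :
    H *ᵥ z = 0 := by
  have h1 : star z ⬝ᵥ (H' *ᵥ z) = 0 := by rw [hz, dotProduct_zero]
  have h2 := hle.dotProduct_mulVec_nonneg z
  rw [sub_mulVec, dotProduct_sub, h1, zero_sub] at h2
  have h3 : star z ⬝ᵥ (H *ᵥ z) = 0 := le_antisymm (neg_nonneg.mp h2) (hH.dotProduct_mulVec_nonneg z)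
  exact (hH.dotProduct_mulVec_zero_iff z).mp h3

/-- **THE CANONICAL CONSTRAINED COVARIANCE IS ANTITONE IN THE FORM.**  `H ≤ H′` PSD (degenerate allowed), hard rows `Q`, a test matrix `T`
killing the constrained zero modes of the SMALLER form (`Q z = 0 ∧ H z = 0 ⟹ T z = 0`).  Then `T·critCov H′ Q·Tᴴ ≤ T·critCov H Q·Tᴴ`. [folklore] -/
theorem readOut_critCov_antitone_form [DecidableEq τ] {H H' : Matrix n n 𝕜} (hH : H.PosSemidef) (hH' : H'.PosSemidef)
    (hle : (H' - H).PosSemidef) (Q : Matrix m n 𝕜) (T : Matrix τ n 𝕜) (hT : ∀ z, Q *ᵥ z = 0 → H *ᵥ z = 0 → T *ᵥ z = 0) :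
    (T * critCov hH.isHermitian Q * Tᴴ - T * critCov hH'.isHermitian Q * Tᴴ).PosSemidef := by
  have h1 : (T * critCov hH.isHermitian Q * Tᴴ).IsHermitian := Matrix.isHermitian_mul_mul_conjTranspose _ (critCov_isHermitian _ _)
  have h2 : (T * critCov hH'.isHermitian Q * Tᴴ).IsHermitian := Matrix.isHermitian_mul_mul_conjTranspose _ (critCov_isHermitian _ _)
  refine PosSemidef.of_dotProduct_mulVec_nonneg (h1.sub h2) fun u => ?_
  rw [sub_mulVec, dotProduct_sub, sub_nonneg, readOut_quad, readOut_quad]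
  set r := Tᴴ *ᵥ u with hr
  have hleg : ∀ z, Q *ᵥ z = 0 → H *ᵥ z = 0 → star z ⬝ᵥ r = 0 := by
    intro z hzQ hzH
    rw [hr, ← conj_pairing, hT z hzQ hzH, star_zero, zero_dotProduct]
  have hleg' : ∀ z, Q *ᵥ z = 0 → H' *ᵥ z = 0 → star z ⬝ᵥ r = 0 := fun z hzQ hzH' => hleg z hzQ (ker_of_ker_larger hH hle hzH')
  have hv := isCrit_critCov hH Q hleg
  have hv' := isCrit_critCov hH' Q hleg'
  calc star r ⬝ᵥ (critCov hH'.isHermitian Q *ᵥ r)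
      = qfun H' r (critCov hH'.isHermitian Q *ᵥ r) := (qfun_crit_eq_pairing hv').symm
    _ ≤ qfun H r (critCov hH'.isHermitian Q *ᵥ r) := qfun_mono_form hle r _
    _ ≤ qfun H r (critCov hH.isHermitian Q *ᵥ r) := qfun_le_of_isCrit hH hv (critCov_mem_ker hH'.isHermitian Q r)
    _ = star r ⬝ᵥ (critCov hH.isHermitian Q *ᵥ r) := qfun_crit_eq_pairing hv

end Abstract

/-! ## §2 The soft form on the torus tower: `2Δ_k + a′·RₛᴴRₛ` -/

section Torus

variable {d : ℕ} (Lc : ℕ) [NeZero Lc] (M : Fin d → ℕ) [hM : ∀ μ, NeZero (M μ)]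
variable {cs : Type*} [Fintype cs]

/-- **THE SOFT FORM at level `k`**: `effAction k + a′ • RₛᴴRₛ` — the `k`-step effective action plus a quadratic weight on the soft rows `Rₛ`
(the next averaging). [folklore] -/
def softForm (k : ℕ) (Rs : Matrix cs (Tor M × Fin d) ℂ) (a' : ℝ) : Matrix (Tor M × Fin d) (Tor M × Fin d) ℂ :=
  effAction Lc M k + ((a' : ℝ) : ℂ) • (Rsᴴ * Rs)

/-- `softForm = 2 • Δ_k + a′ • RₛᴴRₛ` on the printed object (tree def `DelK`, (1.65)). [folklore] -/
theorem softForm_eq_DelK (k : ℕ) (Rs : Matrix cs (Tor M × Fin d) ℂ) (a' a : ℝ) (ha : 0 < a) :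
    softForm Lc M k Rs a' = (2 : ℂ) • DelK (Lc ^ k) (one_le_pow_Lc Lc k) M a ha + ((a' : ℝ) : ℂ) • (Rsᴴ * Rs) := by
  rw [softForm, effAction_eq_two_smul_DelK Lc M k a ha]

omit hM in
/-- The weight term is Hermitian. [folklore] -/
theorem weight_isHermitian (Rs : Matrix cs (Tor M × Fin d) ℂ) (a' : ℝ) : (((a' : ℝ) : ℂ) • (Rsᴴ * Rs)).IsHermitian :=
  (Matrix.isHermitian_conjTranspose_mul_self Rs).smul (by rw [IsSelfAdjoint, Complex.star_def, Complex.conj_ofReal])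

/-- The weight term is PSD for `a′ ≥ 0`. [folklore] -/
theorem weight_posSemidef (Rs : Matrix cs (Tor M × Fin d) ℂ) {a' : ℝ} (ha' : 0 ≤ a') : (((a' : ℝ) : ℂ) • (Rsᴴ * Rs)).PosSemidef := by
  refine PosSemidef.of_dotProduct_mulVec_nonneg (weight_isHermitian M Rs a') fun v => ?_
  rw [smul_mulVec, dotProduct_smul, smul_eq_mul]
  exact mul_nonneg (Complex.zero_le_real.mpr ha') ((Matrix.posSemidef_conjTranspose_mul_self Rs).dotProduct_mulVec_nonneg v)

/-- `softForm` is Hermitian. [folklore] -/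
theorem softForm_isHermitian (k : ℕ) (Rs : Matrix cs (Tor M × Fin d) ℂ) (a' : ℝ) : (softForm Lc M k Rs a').IsHermitian :=
  (effAction_isHermitian Lc M k).add (weight_isHermitian M Rs a')

/-- `softForm` is PSD for `a′ ≥ 0`. [folklore] -/
theorem softForm_posSemidef (k : ℕ) (Rs : Matrix cs (Tor M × Fin d) ℂ) {a' : ℝ} (ha' : 0 ≤ a') : (softForm Lc M k Rs a').PosSemidef :=
  (effAction_posSemidef Lc M k).add (weight_posSemidef M Rs ha')

/-- **THE SOFT FORMS INCREASE** in the level (Federbush + (1.17), `effAction_step_mono`) and in the weight: `a₁ ≤ a₂ ⟹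
softForm k Rₛ a₁ ≤ softForm (k+1) Rₛ a₂`. [folklore] -/
theorem softForm_mono (k : ℕ) (Rs : Matrix cs (Tor M × Fin d) ℂ) {a₁ a₂ : ℝ} (h : a₁ ≤ a₂) :
    (softForm Lc M (k + 1) Rs a₂ - softForm Lc M k Rs a₁).PosSemidef := by
  have e : softForm Lc M (k + 1) Rs a₂ - softForm Lc M k Rs a₁
      = (effAction Lc M (k + 1) - effAction Lc M k) + (((a₂ - a₁ : ℝ) : ℂ) • (Rsᴴ * Rs)) := by
    rw [softForm, softForm, Complex.ofReal_sub, sub_smul]; abel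
  rw [e]
  exact (effAction_step_mono Lc M k).add (weight_posSemidef M Rs (sub_nonneg.mpr h))

/-- Monotonicity in the weight alone at a fixed level. [folklore] -/
theorem softForm_mono_weight (k : ℕ) (Rs : Matrix cs (Tor M × Fin d) ℂ) {a₁ a₂ : ℝ} (h : a₁ ≤ a₂) :
    (softForm Lc M k Rs a₂ - softForm Lc M k Rs a₁).PosSemidef := by
  have e : softForm Lc M k Rs a₂ - softForm Lc M k Rs a₁ = ((a₂ - a₁ : ℝ) : ℂ) • (Rsᴴ * Rs) := by
    rw [softForm, softForm, Complex.ofReal_sub, sub_smul]; abel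
  rw [e]
  exact weight_posSemidef M Rs (sub_nonneg.mpr h)

/-- **THE CONSTRAINED ZERO MODES OF THE SOFT FORM ARE INVISIBLE TO THE PLAQUETTES**: `softForm z = 0 ⟹ curlMat z = 0` (`a′ ≥ 0`). [folklore] -/
theorem curlMat_of_softForm_ker (k : ℕ) (Rs : Matrix cs (Tor M × Fin d) ℂ) {a' : ℝ} (ha' : 0 ≤ a') {z : Tor M × Fin d → ℂ}
    (hz : softForm Lc M k Rs a' *ᵥ z = 0) : curlMat M *ᵥ z = 0 := by
  have hle : (softForm Lc M k Rs a' - effAction Lc M k).PosSemidef := by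
    rw [softForm, add_sub_cancel_left]; exact weight_posSemidef M Rs ha'
  exact curlMat_of_effAction_ker Lc M k (ker_of_ker_larger (effAction_posSemidef Lc M k) hle hz)

/-! ## §3 The soft plaquette covariance and its monotonicity in the level -/

variable {ch : Type*} [Fintype ch] [DecidableEq ch]

/-- **THE SOFT PLAQUETTE COVARIANCE at level `k`**: the plaquette read-out of the canonical covariance of the unit-lattice field under
`2Δ_k + a′·RₛᴴRₛ` with hard rows `R_h` (no gauge fixing). [folklore] -/
def softPlaqCov (k : ℕ) (Rs : Matrix cs (Tor M × Fin d) ℂ) (a' : ℝ) (Rh : Matrix ch (Tor M × Fin d) ℂ) :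
    Matrix (Fin d × Fin d × Tor M) (Fin d × Fin d × Tor M) ℂ :=
  curlMat M * critCov (softForm_isHermitian Lc M k Rs a') Rh * (curlMat M)ᴴ

/-- **(MONO-K) FOR THE SOFT CONSTRAINT**: for every `a′ ≥ 0`, every soft-row matrix `Rₛ`, every hard-row matrix `R_h`, every read-out torus and
every `k`: `softPlaqCov (k+1) ≤ softPlaqCov k` in the Loewner order — the gauge-invariant (plaquette) content of the Gaussian-weighted one-step
fluctuation covariance of Bałaban's block action DECREASES with the step; NO rate. [folklore] -/
theorem softPlaqCov_antitone_step (k : ℕ) (Rs : Matrix cs (Tor M × Fin d) ℂ) {a' : ℝ} (ha' : 0 ≤ a') (Rh : Matrix ch (Tor M × Fin d) ℂ) :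
    (softPlaqCov Lc M k Rs a' Rh - softPlaqCov Lc M (k + 1) Rs a' Rh).PosSemidef :=
  readOut_critCov_antitone_form (softForm_posSemidef Lc M k Rs ha') (softForm_posSemidef Lc M (k + 1) Rs ha')
    (softForm_mono Lc M k Rs le_rfl) Rh (curlMat M) fun _ _ hz => curlMat_of_softForm_ker Lc M k Rs ha' hz

/-- The chain over several steps: `softPlaqCov k′ ≤ softPlaqCov k` for `k ≤ k′`. [folklore] -/
theorem softPlaqCov_antitone {k k' : ℕ} (hk : k ≤ k') (Rs : Matrix cs (Tor M × Fin d) ℂ) {a' : ℝ} (ha' : 0 ≤ a')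
    (Rh : Matrix ch (Tor M × Fin d) ℂ) : (softPlaqCov Lc M k Rs a' Rh - softPlaqCov Lc M k' Rs a' Rh).PosSemidef := by
  induction hk with
  | refl => rw [sub_self]; exact PosSemidef.zero
  | @step m _ ih =>
    have e := sub_add_sub_cancel (softPlaqCov Lc M k Rs a' Rh) (softPlaqCov Lc M m Rs a' Rh) (softPlaqCov Lc M (m + 1) Rs a' Rh)
    rw [← e]
    exact ih.add (softPlaqCov_antitone_step Lc M m Rs ha' Rh)

/-- Antitone in the WEIGHT at a fixed level: `a₁ ≤ a₂ ⟹ softPlaqCov k Rₛ a₂ ≤ softPlaqCov k Rₛ a₁` (tightening the Gaussian averaging weight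
lowers the fluctuation covariance; the hard constraint is the infimum). [folklore] -/
theorem softPlaqCov_antitone_weight (k : ℕ) (Rs : Matrix cs (Tor M × Fin d) ℂ) {a₁ a₂ : ℝ} (ha₁ : 0 ≤ a₁) (h : a₁ ≤ a₂)
    (Rh : Matrix ch (Tor M × Fin d) ℂ) : (softPlaqCov Lc M k Rs a₁ Rh - softPlaqCov Lc M k Rs a₂ Rh).PosSemidef :=
  readOut_critCov_antitone_form (softForm_posSemidef Lc M k Rs ha₁) (softForm_posSemidef Lc M k Rs (ha₁.trans h))
    (softForm_mono_weight Lc M k Rs h) Rh (curlMat M) fun _ _ hz => curlMat_of_softForm_ker Lc M k Rs ha₁ hz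

/-- **ZERO WEIGHT RECOVERS GEN 3's PLAQUETTE COVARIANCE**: `softPlaqCov k Rₛ 0 R_h = plaqCov R_h k`. [folklore] -/
theorem softPlaqCov_zero_weight (k : ℕ) (Rs : Matrix cs (Tor M × Fin d) ℂ) (Rh : Matrix ch (Tor M × Fin d) ℂ) :
    softPlaqCov Lc M k Rs 0 Rh = plaqCov Lc M Rh k := by
  have e : softForm Lc M k Rs 0 = effAction Lc M k := by rw [softForm, Complex.ofReal_zero, zero_smul, add_zero]
  rw [softPlaqCov, plaqCov_eq_critCov_effAction, critCov_congr (softForm_isHermitian Lc M k Rs 0) (effAction_isHermitian Lc M k) e]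

/-- `softPlaqCov` is PSD (a covariance block). [folklore] -/
theorem softPlaqCov_posSemidef (k : ℕ) (Rs : Matrix cs (Tor M × Fin d) ℂ) {a' : ℝ} (ha' : 0 ≤ a') (Rh : Matrix ch (Tor M × Fin d) ℂ) :
    (softPlaqCov Lc M k Rs a' Rh).PosSemidef := by
  refine PosSemidef.of_dotProduct_mulVec_nonneg (Matrix.isHermitian_mul_mul_conjTranspose _ (critCov_isHermitian _ _)) fun u => ?_
  rw [softPlaqCov, readOut_quad]
  set r := (curlMat M)ᴴ *ᵥ u with hr
  have hleg : ∀ z, Rh *ᵥ z = 0 → softForm Lc M k Rs a' *ᵥ z = 0 → star z ⬝ᵥ r = 0 := by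
    intro z _ hzH
    rw [hr, ← conj_pairing, curlMat_of_softForm_ker Lc M k Rs ha' hzH, star_zero, zero_dotProduct]
  have hv := isCrit_critCov (softForm_posSemidef Lc M k Rs ha') Rh hleg
  rw [← qfun_crit_eq_pairing hv]
  have h0 := qfun_le_of_isCrit (softForm_posSemidef Lc M k Rs ha') hv (Submodule.zero_mem _)
  have e0 : qfun (softForm Lc M k Rs a') r 0 = 0 := by simp [qfun]
  rw [e0] at h0
  exact h0

end Torus

/-! ## §4 (v1.1, append-only) ANY `k`-independent positive weight: `effAction k + W` -/

section General

variable {d : ℕ} (Lc : ℕ) [NeZero Lc] (M : Fin d → ℕ) [hM : ∀ μ, NeZero (M μ)]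
variable {ch : Type*} [Fintype ch] [DecidableEq ch]

/-- **THE GENERAL WEIGHTED FORM**: `effAction k + W` for an arbitrary `k`-INDEPENDENT Hermitian PSD weight `W` on the unit-lattice 1-forms — any FIXED
PSD addition to the HARD `k`-step action `2Δ_k`: a Gaussian weight `a′·RₛᴴRₛ` on the NEXT averaging only (§2 `softForm`), or the shift `a·1` of the
marginal precision `(Q_kG_aQ_k*)⁻¹ = a·1 + Δ_k` of the block average (tree `BlockEffectiveAction.QGQ_inv_eq`, [B5] (1.102)).  v1.2 DOCFIX (conceded to
the cross-read C-gan24leaf16-g18-1): the v1.1 gloss «covers the printed soft scheme … `= Δ_k + a·1 + a′·Q_LᴴQ_L`» is WITHDRAWN — the block action of a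
tower Gaussian-averaged at EVERY level is the PARALLEL SUM `(Δ_k⁻¹ + a_k⁻¹)⁻¹` with a level-dependent weight `a_k` (scalar template), NOT of the form
`effAction k + W`; its (MONO-K) is not a corollary of this section and is NOT claimed. [folklore] -/
def genForm (k : ℕ) (W : Matrix (Tor M × Fin d) (Tor M × Fin d) ℂ) : Matrix (Tor M × Fin d) (Tor M × Fin d) ℂ :=
  effAction Lc M k + W

/-- `genForm` is Hermitian for Hermitian `W`. [folklore] -/
theorem genForm_isHermitian (k : ℕ) {W : Matrix (Tor M × Fin d) (Tor M × Fin d) ℂ} (hW : W.PosSemidef) :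
    (genForm Lc M k W).IsHermitian :=
  (effAction_isHermitian Lc M k).add hW.isHermitian

/-- `genForm` is PSD for PSD `W`. [folklore] -/
theorem genForm_posSemidef (k : ℕ) {W : Matrix (Tor M × Fin d) (Tor M × Fin d) ℂ} (hW : W.PosSemidef) :
    (genForm Lc M k W).PosSemidef :=
  (effAction_posSemidef Lc M k).add hW

/-- `genForm` increases with the level (the weight is `k`-independent). [folklore] -/
theorem genForm_step_mono (k : ℕ) (W : Matrix (Tor M × Fin d) (Tor M × Fin d) ℂ) :
    (genForm Lc M (k + 1) W - genForm Lc M k W).PosSemidef := by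
  rw [genForm, genForm, add_sub_add_right_eq_sub]
  exact effAction_step_mono Lc M k

/-- The constrained zero modes of `genForm` are invisible to the plaquettes. [folklore] -/
theorem curlMat_of_genForm_ker (k : ℕ) {W : Matrix (Tor M × Fin d) (Tor M × Fin d) ℂ} (hW : W.PosSemidef) {z : Tor M × Fin d → ℂ}
    (hz : genForm Lc M k W *ᵥ z = 0) : curlMat M *ᵥ z = 0 := by
  have hle : (genForm Lc M k W - effAction Lc M k).PosSemidef := by rw [genForm, add_sub_cancel_left]; exact hW
  exact curlMat_of_effAction_ker Lc M k (ker_of_ker_larger (effAction_posSemidef Lc M k) hle hz)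

/-- **THE WEIGHTED PLAQUETTE COVARIANCE** `curlMat · critCov (effAction k + W) R_h · curlMatᴴ`. [folklore] -/
def genPlaqCov (k : ℕ) {W : Matrix (Tor M × Fin d) (Tor M × Fin d) ℂ} (hW : W.PosSemidef) (Rh : Matrix ch (Tor M × Fin d) ℂ) :
    Matrix (Fin d × Fin d × Tor M) (Fin d × Fin d × Tor M) ℂ :=
  curlMat M * critCov (genForm_isHermitian Lc M k hW) Rh * (curlMat M)ᴴ

/-- **(MONO-K) FOR EVERY `k`-INDEPENDENT PSD WEIGHT**: `genPlaqCov (k+1) ≤ genPlaqCov k` in the Loewner order, every `W ≥ 0`, every hard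
rows `R_h`, every read-out torus, every `k`; NO rate. [folklore] -/
theorem genPlaqCov_antitone_step (k : ℕ) {W : Matrix (Tor M × Fin d) (Tor M × Fin d) ℂ} (hW : W.PosSemidef)
    (Rh : Matrix ch (Tor M × Fin d) ℂ) : (genPlaqCov Lc M k hW Rh - genPlaqCov Lc M (k + 1) hW Rh).PosSemidef :=
  readOut_critCov_antitone_form (genForm_posSemidef Lc M k hW) (genForm_posSemidef Lc M (k + 1) hW) (genForm_step_mono Lc M k W) Rh
    (curlMat M) fun _ _ hz => curlMat_of_genForm_ker Lc M k hW hz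

/-- The chain: `genPlaqCov k′ ≤ genPlaqCov k` for `k ≤ k′`. [folklore] -/
theorem genPlaqCov_antitone {k k' : ℕ} (hk : k ≤ k') {W : Matrix (Tor M × Fin d) (Tor M × Fin d) ℂ} (hW : W.PosSemidef)
    (Rh : Matrix ch (Tor M × Fin d) ℂ) : (genPlaqCov Lc M k hW Rh - genPlaqCov Lc M k' hW Rh).PosSemidef := by
  induction hk with
  | refl => rw [sub_self]; exact PosSemidef.zero
  | @step m _ ih =>
    have e := sub_add_sub_cancel (genPlaqCov Lc M k hW Rh) (genPlaqCov Lc M m hW Rh) (genPlaqCov Lc M (m + 1) hW Rh)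
    rw [← e]
    exact ih.add (genPlaqCov_antitone_step Lc M m hW Rh)

/-- The soft form is the case `W = a′ • RₛᴴRₛ`: `genPlaqCov k (weight) R_h = softPlaqCov k Rₛ a′ R_h`. [folklore] -/
theorem genPlaqCov_weight_eq_softPlaqCov (k : ℕ) {cs : Type*} [Fintype cs] (Rs : Matrix cs (Tor M × Fin d) ℂ) {a' : ℝ} (ha' : 0 ≤ a')
    (Rh : Matrix ch (Tor M × Fin d) ℂ) : genPlaqCov Lc M k (weight_posSemidef M Rs ha') Rh = softPlaqCov Lc M k Rs a' Rh := by
  rw [genPlaqCov, softPlaqCov, critCov_congr (genForm_isHermitian Lc M k (weight_posSemidef M Rs ha')) (softForm_isHermitian Lc M k Rs a') rfl]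

end General

/-! ## §5 (v1.2, append-only) THE SANDWICH `plaqCov (Rₛ ⊕ R_h) k ≤ softPlaqCov k Rₛ a′ R_h ≤ plaqCov R_h k` — «the hard constraint is the infimum»

The §3 gloss «the hard constraint is the infimum over the soft weights» as a theorem: imposing the soft rows HARD gives the SMALLEST plaquette
covariance, dropping them the LARGEST, and every Gaussian weight `a′ ≥ 0` lies between (Loewner).  Abstract input: MORE HARD ROWS under `H` ≤ a SOFT
WEIGHT under any `H′` that agrees with `H` on `ker Rₛ` (gen 2's `qfun_le_of_isCrit` on `ker R_h ⊇ ker (Rₛ ⊕ R_h)`).  Statements and proofs adapted from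
the cross-reader's scratch probe (C-gan24leaf16-g17-1 (P4)∕(P5), leaf-16-g17), re-proved here. -/

section Sandwich

variable {𝕜 : Type*} [RCLike 𝕜] {n ms mh τ : Type*} [Fintype n] [DecidableEq n] [Fintype ms] [DecidableEq ms]
  [Fintype mh] [DecidableEq mh] [Fintype τ]

/-- **MORE HARD ROWS ≤ A SOFT WEIGHT** (abstract, every RCLike field): if `H′` agrees with `H` on `ker Rₛ` (e.g. `H′ = H + a′·RₛᴴRₛ`), then the read-out
covariance constrained by `Rₛ ⊕ R_h` under `H` is BELOW the one constrained by `R_h` alone under `H′`, on every test matrix killing the zero modes of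
both forms. [folklore] -/
theorem readOut_critCov_rows_le_weight [DecidableEq τ] {H H' : Matrix n n 𝕜} (hH : H.PosSemidef) (hH' : H'.PosSemidef)
    (Rs : Matrix ms n 𝕜) (Rh : Matrix mh n 𝕜) (hker : ∀ v, Rs *ᵥ v = 0 → H' *ᵥ v = H *ᵥ v)
    (T : Matrix τ n 𝕜) (hT : ∀ z, H *ᵥ z = 0 → T *ᵥ z = 0) (hT' : ∀ z, H' *ᵥ z = 0 → T *ᵥ z = 0) :
    (T * critCov hH'.isHermitian Rh * Tᴴ - T * critCov hH.isHermitian (Matrix.fromRows Rs Rh) * Tᴴ).PosSemidef := by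
  have h1 : (T * critCov hH'.isHermitian Rh * Tᴴ).IsHermitian :=
    Matrix.isHermitian_mul_mul_conjTranspose _ (critCov_isHermitian _ _)
  have h2 : (T * critCov hH.isHermitian (Matrix.fromRows Rs Rh) * Tᴴ).IsHermitian :=
    Matrix.isHermitian_mul_mul_conjTranspose _ (critCov_isHermitian _ _)
  refine PosSemidef.of_dotProduct_mulVec_nonneg (h1.sub h2) fun u => ?_
  rw [sub_mulVec, dotProduct_sub, sub_nonneg, readOut_quad, readOut_quad]
  set r := Tᴴ *ᵥ u with hr
  have hleg : ∀ z, Matrix.fromRows Rs Rh *ᵥ z = 0 → H *ᵥ z = 0 → star z ⬝ᵥ r = 0 := by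
    intro z _ hzH
    rw [hr, ← conj_pairing, hT z hzH, star_zero, zero_dotProduct]
  have hleg' : ∀ z, Rh *ᵥ z = 0 → H' *ᵥ z = 0 → star z ⬝ᵥ r = 0 := by
    intro z _ hzH
    rw [hr, ← conj_pairing, hT' z hzH, star_zero, zero_dotProduct]
  have hv := isCrit_critCov hH (Matrix.fromRows Rs Rh) hleg
  have hv' := isCrit_critCov hH' Rh hleg'
  set v := critCov hH.isHermitian (Matrix.fromRows Rs Rh) *ᵥ r with hvdef
  have hQ : Matrix.fromRows Rs Rh *ᵥ v = 0 := MonotoneCritical.mulVec_critCov_mem_ker hH.isHermitian _ r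
  have hRs : Rs *ᵥ v = 0 := by
    funext i
    have h := congrFun hQ (Sum.inl i)
    rwa [Matrix.fromRows_mulVec, Sum.elim_inl] at h
  have hRh : Rh *ᵥ v = 0 := by
    funext i
    have h := congrFun hQ (Sum.inr i)
    rwa [Matrix.fromRows_mulVec, Sum.elim_inr] at h
  have hvRh : v ∈ LinearMap.ker Rh.mulVecLin := by
    simpa [LinearMap.mem_ker, Matrix.mulVecLin_apply] using hRh
  calc star r ⬝ᵥ (critCov hH.isHermitian (Matrix.fromRows Rs Rh) *ᵥ r)
      = qfun H r v := (qfun_crit_eq_pairing hv).symm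
    _ = qfun H' r v := by unfold qfun; rw [hker v hRs]
    _ ≤ qfun H' r (critCov hH'.isHermitian Rh *ᵥ r) := qfun_le_of_isCrit hH' hv' hvRh
    _ = star r ⬝ᵥ (critCov hH'.isHermitian Rh *ᵥ r) := qfun_crit_eq_pairing hv'

variable {d : ℕ} (Lc : ℕ) [NeZero Lc] (M : Fin d → ℕ) [hM : ∀ μ, NeZero (M μ)]
variable {cs ch : Type*} [Fintype cs] [Fintype ch] [DecidableEq ch]

/-- **SANDWICH, upper half**: `softPlaqCov k Rₛ a′ R_h ≤ plaqCov R_h k` for every `a′ ≥ 0` — a soft weight on extra rows only LOWERS the plaquette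
covariance relative to no such rows (`softPlaqCov_antitone_weight` at `a₁ = 0` + `softPlaqCov_zero_weight`). [folklore] -/
theorem softPlaqCov_le_plaqCov (k : ℕ) (Rs : Matrix cs (Tor M × Fin d) ℂ) {a' : ℝ} (ha' : 0 ≤ a') (Rh : Matrix ch (Tor M × Fin d) ℂ) :
    (plaqCov Lc M Rh k - softPlaqCov Lc M k Rs a' Rh).PosSemidef := by
  have h := softPlaqCov_antitone_weight Lc M k Rs le_rfl ha' Rh
  rwa [softPlaqCov_zero_weight] at h

/-- **SANDWICH, lower half — THE HARD CONSTRAINT IS THE INFIMUM**: `plaqCov (Rₛ ⊕ R_h) k ≤ softPlaqCov k Rₛ a′ R_h` for every `a′ ≥ 0` — imposing the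
soft rows HARD (δ-function averaging, the form of record for the gauge field) gives the SMALLEST plaquette covariance. [folklore] -/
theorem plaqCov_hardRows_le_softPlaqCov [DecidableEq cs] (k : ℕ) (Rs : Matrix cs (Tor M × Fin d) ℂ) {a' : ℝ} (ha' : 0 ≤ a')
    (Rh : Matrix ch (Tor M × Fin d) ℂ) :
    (softPlaqCov Lc M k Rs a' Rh - plaqCov Lc M (Matrix.fromRows Rs Rh) k).PosSemidef := by
  rw [softPlaqCov, plaqCov_eq_critCov_effAction]
  refine readOut_critCov_rows_le_weight (effAction_posSemidef Lc M k) (softForm_posSemidef Lc M k Rs ha') Rs Rh ?_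
    (curlMat M) (fun z hz => curlMat_of_effAction_ker Lc M k hz) (fun z hz => curlMat_of_softForm_ker Lc M k Rs ha' hz)
  intro v hv
  rw [softForm, add_mulVec, smul_mulVec, ← mulVec_mulVec, hv, mulVec_zero, smul_zero, add_zero]

/-- **Gen 3's plaquette covariance is ANTITONE IN THE HARD ROWS**: `plaqCov (Rₛ ⊕ R_h) k ≤ plaqCov R_h k` (the two halves of the sandwich at
`a′ = 0`) — more averaging constraints, smaller constrained covariance. [folklore] -/
theorem plaqCov_antitone_rows [DecidableEq cs] (k : ℕ) (Rs : Matrix cs (Tor M × Fin d) ℂ) (Rh : Matrix ch (Tor M × Fin d) ℂ) :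
    (plaqCov Lc M Rh k - plaqCov Lc M (Matrix.fromRows Rs Rh) k).PosSemidef := by
  have h := plaqCov_hardRows_le_softPlaqCov Lc M k Rs le_rfl Rh
  rwa [softPlaqCov_zero_weight] at h

end Sandwich

end Summit.QuantumFields.BalabanUV.Beta.GAN24.MonotoneTorusSoft
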